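import Literature.Computability.QuantumComplexity.StabilizerRankLowerBoundsProofs
import Literature.Computability.QuantumComplexity.ApproxStabilizerRankTransferProofs
import HarnessLib

/-!
# The stabilizer fidelity and the stabilizer extent of `|T⟩^{⊗n}`: the dual witness

Bravyi–Gosset (PRL 116 (2016) 250501 = arXiv:1601.07601, Suppl. §5 Lemma 2 and eq. (max1)) and
Bravyi–Browne–Calpin–Campbell–Gosset–Howard (Quantum 3 (2019) 181 = arXiv:1808.00128, §2.1 Def. 3,
§2.2 Def. 4, Prop. 2, §5.3): the maximal overlap of the magic state `|T⟩^{⊗n}`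
(`magicT = 2^{-1/2}(|0⟩ + e^{iπ/4}|1⟩)`, `tensorPow`) with a stabilizer state is
`F(T^{⊗n}) = cos(π/8)^{2n}`, and — by weak duality for the `ℓ₁`-minimisation defining the stabilizer
extent, with the dual vector `ω = T^{⊗n}` itself — every stabilizer decomposition
`T^{⊗n} = Σᵢ cᵢ φᵢ` has `(Σᵢ |cᵢ|)² ≥ cos(π/8)^{-2n} = (4 - 2√2)^n = 2^{γ n}`, `γ ∈ (0.2284, 0.2285)`,
with equality for the product decomposition over `|+⟩, |+i⟩` that the tree already uses as the INPUT
of `BravyiEtAl2019_approxStabilizerRank_magicT_pow_holds` (so that input is optimal: `ξ(T^{⊗n}) =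
cos(π/8)^{-2n}` exactly). Corollary (BG16 Lemma 2 with its constant): a `k`-term decomposition has
`k·‖c‖₂² ≥ cos(π/8)^{-2n}`, and pairwise-orthogonal stabilizer terms force `k ≥ cos(π/8)^{-2n}`.

## Contents (all statements PROVED here; no named facts)

* §1 (E1) `weightEnum_le_pow`: for a nonempty ternary-closed (`= affine`, a coset `u + W`)
  `A ⊆ 𝔽₂ⁿ` with `|A| = 2^k` and `τ ∈ [0,1]`, `Σ_{v∈A} τ^{|v|} ≤ (1+τ)^k` — by slicing along the first
  coordinate (both slices are affine; if both are inhabited, translation by `a₀ + a₁` makes them the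
  same size); equality at `A = 𝔽₂ⁿ` (`weightEnum_univ`) and at coordinate subcubes; squared form
  `weightEnum_sq_le_card`: `(Σ_{v∈A} τ^{|v|})² ≤ |A|` once `(1+τ)² ≤ 2`.
* §2 `exists_affine_support`: a stabilizer state read on `𝔽₂ⁿ` (`PelegShpilkaVolk.flat`) has modulus
  `|c|` on a nonempty affine `A` and `0` elsewhere, `‖φ‖² = |c|²|A| = 1` — from the tree's structure
  theorem `PelegShpilkaVolk.isStabFn_flat_of_mem` (Dehaene–De Moor / Van den Nest form).
* §3 inner-product algebra: unitary invariance, triangle inequality, `⟨ψ⊗φ|ψ'⊗φ'⟩ = ⟨ψ|ψ'⟩⟨φ|φ'⟩`,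
  `⟨ψ^{⊗m}|ψ'^{⊗m}⟩ = ⟨ψ|ψ'⟩^m`, tensor powers of stabilizer states are stabilizer states.
* §4 (E3) `norm_sq_dotProduct_tensorPow_magicT_le` / `stabilizer_overlap_sq_le_cos`:
  `|⟨φ|T^{⊗n}⟩|² ≤ cos(π/8)^{2n}` for every stabilizer `φ`. THE CHAIN (re-derivable in one pass):
  transfer by the Clifford layer `H^{⊗n}` (`PelegShpilkaVolk.hadLayer_mulVec_tensorPow`, unitary
  invariance) ↦ `|⟨φ|T^{⊗n}⟩| = |⟨H^{⊗n}φ|(H|T⟩)^{⊗n}⟩|`; the moduli of `(H|T⟩)^{⊗n}` are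
  `C^{n-|v|} S^{|v|} = Cⁿ τ^{|v|}` with `C = |1+ω|/2 = cos(π/8)`, `S = |1-ω|/2 = sin(π/8)`,
  `τ = S/C = tan(π/8) = √2 - 1` (`PelegShpilkaVolk.flat_tensorPow_hGate_magicT`); `H^{⊗n}φ` is a
  stabilizer state, so by §2 its moduli are `|c|·𝟙_A`; the triangle inequality gives
  `|⟨·|·⟩| ≤ |c| Cⁿ Σ_{v∈A} τ^{|v|}`; (E1) with `(1+τ)² = 2` gives `(Σ_{v∈A} τ^{|v|})² ≤ |A|`, and
  `|c|²|A| = 1`. Equality at `φ = |+⟩^{⊗n}` (`norm_sq_dotProduct_plusPow_magicT`, `⟨+|T⟩ = (1+ω)/2`).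
* §5 (E2) `weak_duality` (`|⟨ω|ψ⟩| ≤ f·Σ|cᵢ|` when `|⟨φᵢ|ω⟩| ≤ f`), (E4) `extent_floor` /
  `extent_floor_cos`, (E5) `card_mul_l2_ge` (Cauchy–Schwarz) and `card_ge_of_orthogonal`.
* §6 the record: `stabilizerFidelity` (an `sSup`, here a maximum: `isGreatest_fidelitySet_…`) and
  `stabilizerExtent` (an `sInf`, here a minimum: `isLeast_extentSet_…`, attained by
  `exists_decomposition_attaining`) of `T^{⊗n}` EXACTLY; `ξ(T) = cos(π/8)^{-2} = 4 - 2√2`,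
  `1.17157 < ξ(T) < 1.171574`, `γ = log₂ ξ(T) ∈ (0.2284, 0.2285)` (`gamma_bounds`, via
  `2^{45} < 1.17157^{197}` and `1.171574^{232} < 2^{53}`), `2^{0.2284 n} ≤ ξ(T^{⊗n})`;
  numbers: `F(T) = cos²(π/8) ∈ (0.85355, 0.85356)`, `F(T^{⊗2}) = cos⁴(π/8) ≈ 0.72855`.

## Honest scope

These are inequalities about inner products of ONE product state with stabilizer states: lower bounds
for the EXTENT / `ℓ₁` / well-conditioned (few-term ⇒ large `ℓ₂`) / orthogonal decomposition classes
only. They do NOT bound the unrestricted exact stabilizer rank (the tree's floor stays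
Peleg–Shpilka–Volk `Ω(n)`, `StabilizerRankLowerBounds`) nor the approximate rank (Mehraban–Tahmasbi
`Ω̃(n²)` barrier, in tree); Bravyi–Gosset's conjecture `χ_δ(T^{⊗n}) = Ω(cos(π/8)^{-2n})`
(arXiv:1601.07601 Suppl. §5, last paragraph) is OPEN and NOT claimed. The newest consumer of
`F(T^{⊗n})` in print is Kalra–Sinha, Quantum 10, 2179 (2026) = arXiv:2503.04101, Thm 1–2 / Cor. 3
(fidelity vs rank via Barnes–Wall lattices) — not typed here. Honest placement against the tree: the Pauli-moment
dual `PauliMoments.StabFrame.fidelity_pow_le_moment` (PauliMomentStabilizerBounds.lean) bounds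
stabilizer overlaps of any state through its Pauli `2k`-moments and is not tight on `T^{⊗n}`
(`k = 2` gives `(3/4)^{n/2} ≈ 0.866ⁿ` against the exact `cos²(π/8)ⁿ ≈ 0.8536ⁿ` here). No simulation
algorithm is built or improved; nothing here proves or refutes quantum advantage (BQP vs BPP untouched).

References: [cite: BravyiGosset2016, Suppl. §5 Lemma 2, eq. (max1)]; [cite: BravyiEtAl2019, §2.1
Def. 3, §2.2 Def. 4, Prop. 2, §5.3]; [cite: BravyiSmithSmolin2016, App. C]; [cite:
PelegShpilkaVolk2022, §2.1, Thm. 3.2]; Nielsen–Chuang 2010 §2.1.6–2.1.7, §10.5 (folklore algebra).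
-/

noncomputable section

namespace Literature.Computability.QuantumComplexity

open Cryptography Matrix

namespace StabilizerFidelity

open PelegShpilkaVolk ApproxRankTransfer
open scoped Classical

/-! ### §1 The affine weight enumerator (E1) -/

section affine

variable {n : ℕ}

/-- `A ⊆ 𝔽₂ⁿ` is closed under `x + y + z` — a nonempty such set is exactly a coset `u + W` of a linear
subspace, i.e. an affine subspace (the supports of stabilizer functions).
[cite: PelegShpilkaVolk2022, §2.1 (affine subspaces `u + V ⊆ 𝔽₂ⁿ`; here as ternary-closed finite sets)] -/
def IsAffineSet (A : Finset (BVec n)) : Prop := ∀ x ∈ A, ∀ y ∈ A, ∀ z ∈ A, x + y + z ∈ A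

/-- The weight enumerator `Σ_{v ∈ A} τ^{|v|}` of a finite set of bit vectors (folklore coding-theory
object; here the bookkeeping device for eq. (max1)). [cite: BravyiGosset2016, Suppl. §5 Lemma 2 (proof of eq. (max1))] -/
def weightEnum (τ : ℝ) (A : Finset (BVec n)) : ℝ := ∑ v ∈ A, τ ^ hammingNorm v

/-- The weight enumerator is nonnegative for `τ ≥ 0`. [folklore] -/
private theorem weightEnum_nonneg {τ : ℝ} (hτ : 0 ≤ τ) (A : Finset (BVec n)) : 0 ≤ weightEnum τ A :=
  Finset.sum_nonneg fun _ _ => pow_nonneg hτ _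

/-- The slice `{v' : cons b v' ∈ A}` of a set of bit vectors of length `n + 1`. [folklore] -/
private def slice (b : ZMod 2) (A : Finset (BVec (n + 1))) : Finset (BVec n) :=
  Finset.univ.filter fun v' => (Fin.cons b v' : BVec (n + 1)) ∈ A

/-- Membership in a slice. [folklore] -/
private theorem mem_slice {b : ZMod 2} {A : Finset (BVec (n + 1))} {v' : BVec n} :
    v' ∈ slice b A ↔ (Fin.cons b v' : BVec (n + 1)) ∈ A := by
  simp [slice]

/-- `cons` is additive. [folklore] -/
private theorem cons_add_cons (a b : ZMod 2) (x y : BVec n) :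
    (Fin.cons a x : BVec (n + 1)) + Fin.cons b y = Fin.cons (a + b) (x + y) := by
  ext i
  refine Fin.cases ?_ (fun j => ?_) i <;> simp

/-- A sum over `𝔽₂` has two terms. [folklore] -/
private theorem sum_zmod2 {M : Type*} [AddCommMonoid M] (h : ZMod 2 → M) : ∑ b, h b = h 0 + h 1 :=
  Fin.sum_univ_two h

/-- Slicing a sum over `A ⊆ 𝔽₂ⁿ⁺¹` along the first coordinate. [folklore] -/
private theorem sum_eq_sum_slice {M : Type*} [AddCommMonoid M] (A : Finset (BVec (n + 1))) (g : BVec (n + 1) → M) :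
    ∑ v ∈ A, g v = ∑ v' ∈ slice 0 A, g (Fin.cons 0 v') + ∑ v' ∈ slice 1 A, g (Fin.cons 1 v') := by
  have h1 : ∑ v ∈ A, g v = ∑ v, if v ∈ A then g v else 0 := by
    rw [← Finset.sum_filter]; congr 1; ext v; simp
  have h2 : ∀ b : ZMod 2, ∑ v' ∈ slice b A, g (Fin.cons b v') =
      ∑ v' : BVec n, if (Fin.cons b v' : BVec (n + 1)) ∈ A then g (Fin.cons b v') else 0 := by
    intro b
    rw [← Finset.sum_filter]
    rfl
  have h3 : (∑ v : BVec (n + 1), if v ∈ A then g v else 0) =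
      ∑ p : ZMod 2 × BVec n, if (Fin.cons p.1 p.2 : BVec (n + 1)) ∈ A then g (Fin.cons p.1 p.2) else 0 :=
    ((Fin.consEquiv fun _ : Fin (n + 1) => ZMod 2).sum_comp (fun v => if v ∈ A then g v else 0)).symm
  rw [h1, h2, h2, h3, Fintype.sum_prod_type, sum_zmod2]

/-- `|A| = |A₀| + |A₁|` for the two slices. [folklore] -/
private theorem card_eq_card_slice (A : Finset (BVec (n + 1))) :
    A.card = (slice 0 A).card + (slice 1 A).card := by
  have h := sum_eq_sum_slice A (fun _ => (1 : ℕ))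
  simpa using h

/-- The Hamming weight of `cons b v'` is `[b ≠ 0] + |v'|`. [folklore] -/
private theorem hammingNorm_cons (b : ZMod 2) (v' : BVec n) :
    hammingNorm (Fin.cons b v' : BVec (n + 1)) = (if b = 0 then 0 else 1) + hammingNorm v' := by
  simp only [hammingNorm, Finset.card_filter]
  rw [Fin.sum_univ_succ]
  simp only [Fin.cons_zero, Fin.cons_succ]
  by_cases hb : b = 0 <;> simp [hb]

/-- The weight enumerator sliced along the first coordinate: `W(A) = W(A₀) + τ W(A₁)`. [folklore] -/
private theorem weightEnum_succ (τ : ℝ) (A : Finset (BVec (n + 1))) :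
    weightEnum τ A = weightEnum τ (slice 0 A) + τ * weightEnum τ (slice 1 A) := by
  unfold weightEnum
  rw [sum_eq_sum_slice, Finset.mul_sum]
  congr 1
  · refine Finset.sum_congr rfl fun v' _ => ?_
    rw [hammingNorm_cons, if_pos rfl, zero_add]
  · refine Finset.sum_congr rfl fun v' _ => ?_
    rw [hammingNorm_cons, if_neg one_ne_zero, pow_add, pow_one]

/-- Slices of a ternary-closed set are ternary-closed. [folklore] -/
private theorem isAffineSet_slice {A : Finset (BVec (n + 1))} (hA : IsAffineSet A) (b : ZMod 2) :
    IsAffineSet (slice b A) := by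
  intro x hx y hy z hz
  rw [mem_slice] at hx hy hz ⊢
  have h := hA _ hx _ hy _ hz
  rw [cons_add_cons, cons_add_cons] at h
  have hb : b + b + b = b := by rcases zmod2_cases b with rfl | rfl <;> decide
  rwa [hb] at h

/-- If both slices of an affine set are inhabited they have the same size (translation by
`a₀ + a₁` swaps them). [folklore] -/
private theorem card_slice_eq {A : Finset (BVec (n + 1))} (hA : IsAffineSet A) {a₀ a₁ : BVec n}
    (h₀ : a₀ ∈ slice 0 A) (h₁ : a₁ ∈ slice 1 A) : (slice 0 A).card = (slice 1 A).card := by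
  rw [mem_slice] at h₀ h₁
  have key : ∀ (b b' : ZMod 2) (v' : BVec n), (Fin.cons b v' : BVec (n + 1)) ∈ A →
      (Fin.cons (b + 1) (v' + a₀ + a₁) : BVec (n + 1)) ∈ A := by
    intro b _ v' hv
    have h := hA _ hv _ h₀ _ h₁
    rw [cons_add_cons, cons_add_cons, add_zero] at h
    exact h
  apply le_antisymm
  · refine Finset.card_le_card_of_injOn (fun v' => v' + a₀ + a₁) (fun v' hv => ?_) ?_
    · have hv' : (Fin.cons 0 v' : BVec (n + 1)) ∈ A := mem_slice.1 (by simpa using hv)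
      have h := key 0 0 v' hv'
      rw [zero_add] at h
      simpa [mem_slice] using h
    · intro x _ y _ hxy
      exact add_left_injective a₀ (add_left_injective a₁ hxy)
  · refine Finset.card_le_card_of_injOn (fun v' => v' + a₀ + a₁) (fun v' hv => ?_) ?_
    · have hv' : (Fin.cons 1 v' : BVec (n + 1)) ∈ A := mem_slice.1 (by simpa using hv)
      have h := key 1 1 v' hv'
      rw [zmod2_one_add_one] at h
      simpa [mem_slice] using h
    · intro x _ y _ hxy
      exact add_left_injective a₀ (add_left_injective a₁ hxy)

/-- **The affine weight enumerator bound** (counted form): a nonempty ternary-closed `A ⊆ 𝔽₂ⁿ` has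
`|A| = 2^k` for some `k` and `Σ_{v∈A} τ^{|v|} ≤ (1+τ)^k` for every `τ ∈ [0,1]` (slice along a
coordinate: both slices are cosets of half the size, or one is empty). This is the present file's route
to Bravyi–Gosset's eq. (max1) (their proof is an induction over a computational-basis measurement of the
first qubit with `P₀ ∈ {0, ½, 1}`; the slicing here is the same trichotomy read on the support); the
inequality itself is folklore (the `p`-biased measure of an affine subspace of codimension `d` is at most
`(1-p)^d` for `p ≤ ½`). [cite: BravyiGosset2016, Suppl. §5 Lemma 2 (proof of eq. (max1), Cases 1–3)] -/
theorem exists_card_eq_and_weightEnum_le : ∀ {n : ℕ} (A : Finset (BVec n)), IsAffineSet A → A.Nonempty →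
    ∃ k : ℕ, A.card = 2 ^ k ∧ ∀ τ : ℝ, 0 ≤ τ → τ ≤ 1 → weightEnum τ A ≤ (1 + τ) ^ k
  | 0, A, _, hne => by
    have hA : A = {0} := by
      apply Finset.eq_singleton_iff_unique_mem.2
      obtain ⟨a, ha⟩ := hne
      exact ⟨(Subsingleton.elim a 0) ▸ ha, fun x _ => Subsingleton.elim _ _⟩
    refine ⟨0, by rw [hA, Finset.card_singleton]; rfl, fun τ _ _ => le_of_eq ?_⟩
    rw [weightEnum, hA, Finset.sum_singleton, hammingNorm_zero, pow_zero, pow_zero]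
  | n + 1, A, hA, hne => by
    obtain ⟨a, ha⟩ := hne
    -- the witness lies in one of the slices
    have ha' : (Fin.tail a) ∈ slice (a 0) A := by
      rw [mem_slice, Fin.cons_self_tail]; exact ha
    by_cases h0 : (slice 0 A).Nonempty <;> by_cases h1 : (slice 1 A).Nonempty
    · -- both slices inhabited: equal size, IH on each
      obtain ⟨k₀, hk₀, hb₀⟩ := exists_card_eq_and_weightEnum_le _ (isAffineSet_slice hA 0) h0
      obtain ⟨k₁, hk₁, hb₁⟩ := exists_card_eq_and_weightEnum_le _ (isAffineSet_slice hA 1) h1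
      obtain ⟨a₀, ha₀⟩ := h0
      obtain ⟨a₁, ha₁⟩ := h1
      have heq : k₁ = k₀ := by
        have h := card_slice_eq hA ha₀ ha₁
        rw [hk₀, hk₁] at h
        exact Nat.pow_right_injective le_rfl h.symm
      subst heq
      refine ⟨k₁ + 1, by rw [card_eq_card_slice, hk₀, hk₁, pow_succ]; ring, fun τ hτ0 hτ1 => ?_⟩
      rw [weightEnum_succ]
      calc weightEnum τ (slice 0 A) + τ * weightEnum τ (slice 1 A)
          ≤ (1 + τ) ^ k₁ + τ * (1 + τ) ^ k₁ :=
            add_le_add (hb₀ τ hτ0 hτ1) (mul_le_mul_of_nonneg_left (hb₁ τ hτ0 hτ1) hτ0)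
        _ = (1 + τ) ^ (k₁ + 1) := by ring
    · -- slice 1 empty
      obtain ⟨k₀, hk₀, hb₀⟩ := exists_card_eq_and_weightEnum_le _ (isAffineSet_slice hA 0) h0
      have he : slice 1 A = ∅ := Finset.not_nonempty_iff_eq_empty.1 h1
      refine ⟨k₀, by rw [card_eq_card_slice, hk₀, he, Finset.card_empty, add_zero], fun τ hτ0 hτ1 => ?_⟩
      rw [weightEnum_succ, he]
      simp only [weightEnum, Finset.sum_empty, mul_zero, add_zero]
      exact hb₀ τ hτ0 hτ1
    · -- slice 0 empty
      obtain ⟨k₁, hk₁, hb₁⟩ := exists_card_eq_and_weightEnum_le _ (isAffineSet_slice hA 1) h1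
      have he : slice 0 A = ∅ := Finset.not_nonempty_iff_eq_empty.1 h0
      refine ⟨k₁, by rw [card_eq_card_slice, hk₁, he, Finset.card_empty, zero_add], fun τ hτ0 hτ1 => ?_⟩
      rw [weightEnum_succ, he]
      simp only [weightEnum, Finset.sum_empty, zero_add]
      calc τ * ∑ v ∈ slice 1 A, τ ^ hammingNorm v ≤ 1 * ∑ v ∈ slice 1 A, τ ^ hammingNorm v :=
            mul_le_mul_of_nonneg_right hτ1 (weightEnum_nonneg hτ0 _)
        _ ≤ (1 + τ) ^ k₁ := by rw [one_mul]; exact hb₁ τ hτ0 hτ1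
    · exfalso
      rcases zmod2_cases (a 0) with h | h
      · exact h0 ⟨_, h ▸ ha'⟩
      · exact h1 ⟨_, h ▸ ha'⟩

/-- **(E1) The affine weight enumerator bound**: `Σ_{v ∈ A} τ^{|v|} ≤ (1+τ)^k` for every nonempty
ternary-closed `A ⊆ 𝔽₂ⁿ` with `|A| = 2^k` and every `τ ∈ [0,1]`; equality at `A = 𝔽₂ᵏ × {0}^{n-k}`
(and at every coordinate subcube, `weightEnum_univ`). Folklore; this file's route to eq. (max1).
[cite: BravyiGosset2016, Suppl. §5 Lemma 2 (proof of eq. (max1))] -/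
theorem weightEnum_le_pow {A : Finset (BVec n)} (hA : IsAffineSet A) (hne : A.Nonempty) {k : ℕ}
    (hk : A.card = 2 ^ k) {τ : ℝ} (hτ0 : 0 ≤ τ) (hτ1 : τ ≤ 1) : weightEnum τ A ≤ (1 + τ) ^ k := by
  obtain ⟨k', hk', hb⟩ := exists_card_eq_and_weightEnum_le A hA hne
  have : k' = k := Nat.pow_right_injective le_rfl (hk'.symm.trans hk)
  subst this
  exact hb τ hτ0 hτ1

/-- Squared form used below: `(Σ_{v∈A} τ^{|v|})² ≤ |A|` whenever `(1+τ)² ≤ 2` — at `τ = tan(π/8)` this is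
Bravyi–Gosset's `2^{-1/2}(ν + √(1-ν²)) = ν` step iterated. [cite: BravyiGosset2016, Suppl. §5 Lemma 2 (proof of eq. (max1), Case 3)] -/
theorem weightEnum_sq_le_card {A : Finset (BVec n)} (hA : IsAffineSet A) (hne : A.Nonempty)
    {τ : ℝ} (hτ0 : 0 ≤ τ) (hτ1 : τ ≤ 1) (h2 : (1 + τ) ^ 2 ≤ 2) : weightEnum τ A ^ 2 ≤ A.card := by
  obtain ⟨k, hk, hb⟩ := exists_card_eq_and_weightEnum_le A hA hne
  have h := hb τ hτ0 hτ1
  calc weightEnum τ A ^ 2 ≤ ((1 + τ) ^ k) ^ 2 := pow_le_pow_left₀ (weightEnum_nonneg hτ0 A) h 2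
    _ = ((1 + τ) ^ 2) ^ k := by rw [← pow_mul, ← pow_mul, mul_comm]
    _ ≤ 2 ^ k := pow_le_pow_left₀ (by positivity) h2 k
    _ = A.card := by rw [hk]; push_cast; ring

/-- Slices of the full cube are full cubes. [folklore] -/
private theorem slice_univ (b : ZMod 2) : slice b (Finset.univ : Finset (BVec (n + 1))) = Finset.univ := by
  ext v'; simp [slice]

/-- Equality in (E1) at the full space (and, by the same token, at coordinate subcubes):
`Σ_{v ∈ 𝔽₂ⁿ} τ^{|v|} = (1+τ)^n` (the binomial theorem over the cube). Folklore.
[cite: BravyiGosset2016, Suppl. §5 Lemma 2 (proof of eq. (max1): the lower bound `F_t ≥ ν^t` is attained)] -/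
theorem weightEnum_univ (τ : ℝ) : ∀ n, weightEnum τ (Finset.univ : Finset (BVec n)) = (1 + τ) ^ n
  | 0 => by
    have h : (Finset.univ : Finset (BVec 0)) = {0} :=
      Finset.eq_singleton_iff_unique_mem.2 ⟨Finset.mem_univ _, fun x _ => Subsingleton.elim _ _⟩
    rw [weightEnum, h, Finset.sum_singleton, hammingNorm_zero, pow_zero, pow_zero]
  | n + 1 => by
    rw [weightEnum_succ, slice_univ, slice_univ, weightEnum_univ τ n]
    ring

end affine


/-! ### §2 Stabilizer states: unit norm, affine support of constant modulus -/

section support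

variable {n : ℕ}

/-- The bit-vector / Boolean-register transport as an equivalence. [folklore] -/
private def bq : BVec n ≃ QReg n := ⟨toQ, toB, toB_toQ, toQ_toB⟩

/-- Sums over `QReg n` are sums over `𝔽₂ⁿ`. [folklore] -/
private theorem sum_qReg_eq_sum_bvec {M : Type*} [AddCommMonoid M] (g : QReg n → M) :
    ∑ x, g x = ∑ v : BVec n, g (toQ v) :=
  (Fintype.sum_equiv bq (fun v => g (toQ v)) g (fun _ => rfl)).symm

/-- `|(-1)^a| = 1`. [folklore] -/
private theorem norm_sgnZ (a : ZMod 2) : ‖sgnZ a‖ = 1 := by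
  unfold sgnZ; split_ifs <;> simp

/-- `|i^a| = 1`. [folklore] -/
private theorem norm_iPowZ (a : ZMod 2) : ‖iPowZ a‖ = 1 := by
  unfold iPowZ; split_ifs <;> simp [Complex.norm_I]

/-- Stabilizer states `C|x⟩` are unit vectors (Clifford circuits are unitary).
[cite: NielsenChuang2010, §2.1.6 (unitary operators preserve inner products)] -/
theorem normSq_of_mem_stabilizerStates {φ : QReg n → ℂ} (hφ : φ ∈ stabilizerStates n) : normSq φ = 1 := by
  obtain ⟨C, hC, rfl⟩ := hφ
  rw [normSq_mulVec_of_mem_cliffordCircuits hC]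
  exact normSq_basisState _

/-- **Affine support of constant modulus**: a stabilizer state, read on `𝔽₂ⁿ`, has modulus `|c|` on a
nonempty ternary-closed set `A` (a coset `u + W`) and `0` elsewhere, and `‖φ‖² = |c|² |A|` — from the
structure theorem `isStabFn_flat_of_mem` (Dehaene–De Moor). [cite: PelegShpilkaVolk2022, §2.1 eq. (1)] -/
theorem exists_affine_support {φ : QReg n → ℂ} (hφ : φ ∈ stabilizerStates n) :
    ∃ (c : ℂ) (A : Finset (BVec n)), IsAffineSet A ∧ A.Nonempty ∧
      (∀ v, ‖flat φ v‖ = if v ∈ A then ‖c‖ else 0) ∧ normSq φ = ‖c‖ ^ 2 * A.card := by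
  obtain ⟨c, W, u, ℓ, q, _, hF⟩ := isStabFn_flat_of_mem hφ
  set A : Finset (BVec n) := Finset.univ.filter (fun v => v + u ∈ W) with hAdef
  have hmem : ∀ v, v ∈ A ↔ v + u ∈ W := fun v => by simp [hAdef]
  have hnorm : ∀ v, ‖flat φ v‖ = if v ∈ A then ‖c‖ else 0 := by
    intro v
    rw [hF v]
    by_cases hv : v + u ∈ W
    · rw [if_pos hv, if_pos ((hmem v).2 hv), norm_mul, norm_mul, norm_mul, norm_iPowZ, norm_sgnZ]
      simp
    · rw [if_neg hv, if_neg (fun h => hv ((hmem v).1 h))]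
      simp
  refine ⟨c, A, ?_, ⟨u, (hmem u).2 (by rw [bvec_add_self]; exact W.zero_mem)⟩, hnorm, ?_⟩
  · intro x hx y hy z hz
    rw [hmem] at hx hy hz ⊢
    have e : x + y + z + u = (x + u) + (y + u) + (z + u) := by
      have hu : u + u = 0 := bvec_add_self u
      calc x + y + z + u = x + y + z + u + (u + u) := by rw [hu, add_zero]
        _ = (x + u) + (y + u) + (z + u) := by abel
    rw [e]
    exact W.add_mem (W.add_mem hx hy) hz
  · unfold normSq
    rw [sum_qReg_eq_sum_bvec (fun x => ‖φ x‖ ^ 2)]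
    change ∑ v : BVec n, ‖flat φ v‖ ^ 2 = _
    calc ∑ v : BVec n, ‖flat φ v‖ ^ 2 = ∑ v : BVec n, (if v ∈ A then ‖c‖ ^ 2 else 0) := by
          refine Finset.sum_congr rfl fun v _ => ?_
          rw [hnorm v]
          split_ifs <;> simp
      _ = ∑ v ∈ A, ‖c‖ ^ 2 := by
          rw [← Finset.sum_filter]
          congr 1
          ext v
          simp
      _ = ‖c‖ ^ 2 * A.card := by rw [Finset.sum_const, nsmul_eq_mul, mul_comm]

end support

/-! ### §3 Overlaps: unitary invariance, triangle inequality, tensor products -/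

section overlaps

variable {n : ℕ}

/-- **Unitary invariance of the inner product** `⟨Uφ|Uψ⟩ = ⟨φ|ψ⟩`. [cite: NielsenChuang2010, §2.1.6] -/
theorem dotProduct_mulVec_of_mem_unitaryGroup {U : Matrix (QReg n) (QReg n) ℂ}
    (hU : U ∈ Matrix.unitaryGroup (QReg n) ℂ) (φ ψ : QReg n → ℂ) :
    star (U *ᵥ φ) ⬝ᵥ (U *ᵥ ψ) = star φ ⬝ᵥ ψ := by
  rw [Matrix.star_mulVec, ← Matrix.dotProduct_mulVec, Matrix.mulVec_mulVec,
    ← star_eq_conjTranspose, Matrix.mem_unitaryGroup_iff'.1 hU, Matrix.one_mulVec]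

/-- Triangle inequality for the inner product: `|⟨φ|ψ⟩| ≤ Σ_x |φ x| |ψ x|`.
[cite: NielsenChuang2010, §2.1.4 (inner products; `⟨φ|ψ⟩ = Σₓ φₓ* ψₓ`)] -/
theorem norm_dotProduct_le (φ ψ : QReg n → ℂ) : ‖star φ ⬝ᵥ ψ‖ ≤ ∑ x, ‖φ x‖ * ‖ψ x‖ := by
  unfold dotProduct
  refine (norm_sum_le _ _).trans (le_of_eq (Finset.sum_congr rfl fun x _ => ?_))
  rw [Pi.star_apply, norm_mul, norm_star]

/-- `|⟨φ|ψ⟩| = |⟨ψ|φ⟩|`. [folklore] -/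
private theorem norm_dotProduct_comm (φ ψ : QReg n → ℂ) : ‖star φ ⬝ᵥ ψ‖ = ‖star ψ ⬝ᵥ φ‖ := by
  rw [Matrix.star_dotProduct, norm_star]

/-- `⟨ω| Σ cᵢ φᵢ⟩ = Σ cᵢ ⟨ω|φᵢ⟩`. [folklore] -/
private theorem dotProduct_sum_smul {ι : Type*} (s : Finset ι) (ω : QReg n → ℂ) (c : ι → ℂ)
    (φ : ι → QReg n → ℂ) : star ω ⬝ᵥ (∑ i ∈ s, c i • φ i) = ∑ i ∈ s, c i * (star ω ⬝ᵥ φ i) := by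
  rw [dotProduct_sum]
  refine Finset.sum_congr rfl fun i _ => ?_
  rw [dotProduct_smul, smul_eq_mul]

/-- **Inner products of tensor products multiply**: `⟨ψ⊗φ|ψ'⊗φ'⟩ = ⟨ψ|ψ'⟩⟨φ|φ'⟩`.
[cite: NielsenChuang2010, §2.1.7 (eq. (2.49))] -/
theorem dotProduct_tensorVec {a b : ℕ} (ψ ψ' : QReg a → ℂ) (φ φ' : QReg b → ℂ) :
    star (tensorVec ψ φ) ⬝ᵥ tensorVec ψ' φ' = (star ψ ⬝ᵥ ψ') * (star φ ⬝ᵥ φ') := by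
  simp only [dotProduct, Pi.star_apply]
  calc ∑ z, star (tensorVec ψ φ z) * tensorVec ψ' φ' z
      = ∑ q : QReg a × QReg b, star (tensorVec ψ φ (Fin.appendEquiv a b q)) *
          tensorVec ψ' φ' (Fin.appendEquiv a b q) :=
        ((Fin.appendEquiv a b).sum_comp (fun z => star (tensorVec ψ φ z) * tensorVec ψ' φ' z)).symm
    _ = ∑ q : QReg a × QReg b, (star (ψ q.1) * ψ' q.1) * (star (φ q.2) * φ' q.2) :=
        Fintype.sum_congr _ _ fun q => by
          simp only [tensorVec_apply, Fin.appendEquiv, Equiv.coe_fn_mk, Fin.append_left, Fin.append_right,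
            star_mul]
          ring
    _ = (∑ x, star (ψ x) * ψ' x) * ∑ y, star (φ y) * φ' y := by
        rw [Fintype.sum_prod_type, Finset.sum_mul_sum]

/-- `⟨ψ^{⊗m}|ψ'^{⊗m}⟩ = ⟨ψ|ψ'⟩^m`. [cite: NielsenChuang2010, §2.1.7 (eq. (2.49), iterated)] -/
theorem dotProduct_tensorPow (ψ ψ' : QReg 1 → ℂ) :
    ∀ m, star (tensorPow ψ m) ⬝ᵥ tensorPow ψ' m = (star ψ ⬝ᵥ ψ') ^ m
  | 0 => by
    rw [pow_zero, show tensorPow ψ 0 = fun _ => 1 from rfl, show tensorPow ψ' 0 = fun _ => 1 from rfl]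
    simp [dotProduct]
  | m + 1 => by
    rw [tensorPow, tensorPow, dotProduct_tensorVec, dotProduct_tensorPow ψ ψ' m, pow_succ]

/-- Tensor powers of a one-qubit stabilizer state are stabilizer states (Clifford circuits on disjoint
wires compose). [cite: NielsenChuang2010, §10.5.1 (the stabilizer formalism: tensor products)] -/
theorem tensorPow_mem_stabilizerStates {ψ : QReg 1 → ℂ} (hψ : ψ ∈ stabilizerStates 1) :
    ∀ m, tensorPow ψ m ∈ stabilizerStates m
  | 0 => by rw [tensorPow_zero_eq_zeroState]; exact zeroState_mem_stabilizerStates 0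
  | m + 1 => by
    rw [tensorPow]
    exact tensorVec_mem_stabilizerStates (tensorPow_mem_stabilizerStates hψ m) hψ

end overlaps

/-! ### §4 (E3) The stabilizer fidelity of `|T⟩^{⊗n}` is `cos(π/8)^{2n}` -/

section fidelity

variable {n : ℕ}

/-- `C = |1+ω|/2 = cos(π/8) = ν`, the large amplitude modulus of `H|T⟩`.
[cite: BravyiGosset2016, Suppl. §5 (`ν = cos(π/8)`)] -/
def cosT : ℝ := ‖((1 + omega) / 2 : ℂ)‖

/-- `S = |1-ω|/2 = sin(π/8) = √(1-ν²)`, the small amplitude modulus of `H|T⟩`.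
[cite: BravyiGosset2016, Suppl. §5 Lemma 2 (proof, Case 2: `√(1-ν²)`)] -/
def sinT : ℝ := ‖((1 - omega) / 2 : ℂ)‖

/-- `τ = tan(π/8) = √2 - 1 = √(1-ν²)/ν`. [cite: BravyiGosset2016, Suppl. §5 Lemma 2 (proof, Case 3)] -/
def tauT : ℝ := Real.sqrt 2 - 1

/-- `(√2)² = 2`. [folklore] -/
private theorem sqrt2_sq' : Real.sqrt 2 ^ 2 = (2 : ℝ) := Real.sq_sqrt (by norm_num)

/-- `C² = (2+√2)/4`. [folklore] -/
private theorem cosT_sq : cosT ^ 2 = (2 + Real.sqrt 2) / 4 := by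
  unfold cosT
  rw [norm_div, div_pow, norm_one_add_omega_sq]
  norm_num

/-- `S² = (2-√2)/4`. [folklore] -/
private theorem sinT_sq : sinT ^ 2 = (2 - Real.sqrt 2) / 4 := by
  unfold sinT
  rw [norm_div, div_pow, norm_one_sub_omega_sq]
  norm_num

/-- `C² = cos²(π/8) = (2+√2)/4`: the Bravyi–Gosset constant `ν = cos(π/8)` squared.
[cite: BravyiGosset2016, p. 3 (`γ ≤ -2 log₂ cos(π/8) ≈ 0.228`) and Suppl. §5 (`ν = cos(π/8)`)] -/
theorem cosT_sq_eq_cos_sq : cosT ^ 2 = Real.cos (Real.pi / 8) ^ 2 := by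
  rw [cosT_sq, Real.cos_sq, show (2 : ℝ) * (Real.pi / 8) = Real.pi / 4 by ring, Real.cos_pi_div_four]
  ring

/-- `0 ≤ C`. [folklore] -/
private theorem cosT_nonneg : 0 ≤ cosT := norm_nonneg _

/-- `0 ≤ τ = √2 - 1`. [folklore] -/
private theorem tauT_nonneg : 0 ≤ tauT := by
  unfold tauT
  nlinarith [sqrt2_sq', Real.sqrt_nonneg 2]

/-- `τ = √2 - 1 ≤ 1`. [folklore] -/
private theorem tauT_le_one : tauT ≤ 1 := by
  unfold tauT
  nlinarith [sqrt2_sq', Real.sqrt_nonneg 2]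

/-- `(1 + tan(π/8))² = 2`, i.e. `2^{-1/2}(cos(π/8) + sin(π/8)) = cos(π/8)` — the Case-3 identity of
Bravyi–Gosset's induction. [cite: BravyiGosset2016, Suppl. §5 Lemma 2 (proof, Case 3)] -/
theorem one_add_tauT_sq : (1 + tauT) ^ 2 = 2 := by
  unfold tauT
  have hs := sqrt2_sq'
  linear_combination hs

/-- `sin(π/8) = tan(π/8) cos(π/8)` for the moduli. [folklore] -/
private theorem sinT_eq_tauT_mul_cosT : sinT = tauT * cosT := by
  have h1 : 0 ≤ sinT := norm_nonneg _
  have h2 : 0 ≤ tauT * cosT := mul_nonneg tauT_nonneg cosT_nonneg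
  have h3 : sinT ^ 2 = (tauT * cosT) ^ 2 := by
    rw [sinT_sq, mul_pow, cosT_sq]
    unfold tauT
    have hs := sqrt2_sq'
    linear_combination (-(Real.sqrt 2) / 4) * hs
  exact (sq_eq_sq₀ h1 h2).1 h3

/-- The moduli of the transferred magic-state function: `|(H|T⟩)^{⊗n}(v)| = C^n τ^{|v|}`.
[cite: PelegShpilkaVolk2022, Thm. 3.2 (proof)] -/
theorem norm_flat_tensorPow_hGate_magicT (v : BVec n) :
    ‖flat (tensorPow (hGate *ᵥ magicT) n) v‖ = cosT ^ n * tauT ^ hammingNorm v := by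
  have hw : hammingNorm v ≤ n := (hammingNorm_le_card_fintype).trans_eq (Fintype.card_fin n)
  rw [flat_tensorPow_hGate_magicT, norm_mul, norm_pow, norm_pow]
  change cosT ^ (n - hammingNorm v) * sinT ^ hammingNorm v = _
  rw [sinT_eq_tauT_mul_cosT, mul_pow]
  calc cosT ^ (n - hammingNorm v) * (tauT ^ hammingNorm v * cosT ^ hammingNorm v)
      = (cosT ^ (n - hammingNorm v) * cosT ^ hammingNorm v) * tauT ^ hammingNorm v := by ring
    _ = cosT ^ n * tauT ^ hammingNorm v := by rw [← pow_add, Nat.sub_add_cancel hw]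

/-- **(E3) The stabilizer fidelity of `|T⟩^{⊗n}`** (Bravyi–Gosset 2016, Suppl. Lemma 2, eq. (max1):
`F(H^{⊗t}) = cos(π/8)^{2t}`): every stabilizer state `φ` has `|⟨φ|T^{⊗n}⟩|² ≤ C^{2n} = cos(π/8)^{2n}`.
NEW PROOF: transfer by `H^{⊗n}`, affine support of constant modulus, triangle inequality and the
affine weight enumerator bound (E1) at `τ = tan(π/8)`, `(1+τ)² = 2`. [cite: BravyiGosset2016, Suppl. §5 Lemma 2] -/
theorem norm_sq_dotProduct_tensorPow_magicT_le {φ : QReg n → ℂ} (hφ : φ ∈ stabilizerStates n) :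
    ‖star φ ⬝ᵥ tensorPow magicT n‖ ^ 2 ≤ (cosT ^ 2) ^ n := by
  have hL := hadLayer_mem n
  have hLu := cliffordCircuits_le_unitaryGroup n hL
  rw [← dotProduct_mulVec_of_mem_unitaryGroup hLu φ, hadLayer_mulVec_tensorPow]
  have hφ' : hadLayer n *ᵥ φ ∈ stabilizerStates n := mulVec_mem_stabilizerStates hL hφ
  obtain ⟨c, A, hA, hne, hnorm, hnsq⟩ := exists_affine_support hφ'
  have h1 : normSq (hadLayer n *ᵥ φ) = 1 := normSq_of_mem_stabilizerStates hφ'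
  have hb : ‖star (hadLayer n *ᵥ φ) ⬝ᵥ tensorPow (hGate *ᵥ magicT) n‖ ≤
      ‖c‖ * cosT ^ n * weightEnum tauT A := by
    refine (norm_dotProduct_le _ _).trans (le_of_eq ?_)
    rw [sum_qReg_eq_sum_bvec]
    change ∑ v : BVec n, ‖flat (hadLayer n *ᵥ φ) v‖ * ‖flat (tensorPow (hGate *ᵥ magicT) n) v‖ = _
    simp_rw [hnorm, norm_flat_tensorPow_hGate_magicT, ite_mul, zero_mul]
    rw [Finset.sum_ite_mem, Finset.univ_inter, weightEnum, Finset.mul_sum]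
    refine Finset.sum_congr rfl fun v _ => ?_
    ring
  have hw : weightEnum tauT A ^ 2 ≤ A.card :=
    weightEnum_sq_le_card hA hne tauT_nonneg tauT_le_one (le_of_eq one_add_tauT_sq)
  calc ‖star (hadLayer n *ᵥ φ) ⬝ᵥ tensorPow (hGate *ᵥ magicT) n‖ ^ 2
      ≤ (‖c‖ * cosT ^ n * weightEnum tauT A) ^ 2 := pow_le_pow_left₀ (norm_nonneg _) hb 2
    _ = (‖c‖ ^ 2 * weightEnum tauT A ^ 2) * (cosT ^ 2) ^ n := by ring
    _ ≤ (‖c‖ ^ 2 * A.card) * (cosT ^ 2) ^ n := by gcongr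
    _ = (cosT ^ 2) ^ n := by rw [← hnsq, h1, one_mul]

/-- (E3) in printed units: `|⟨φ|T^{⊗n}⟩|² ≤ cos(π/8)^{2n}` for every stabilizer state `φ`.
[cite: BravyiGosset2016, Suppl. §5 Lemma 2] -/
theorem stabilizer_overlap_sq_le_cos {φ : QReg n → ℂ} (hφ : φ ∈ stabilizerStates n) :
    ‖star φ ⬝ᵥ tensorPow magicT n‖ ^ 2 ≤ (Real.cos (Real.pi / 8) ^ 2) ^ n := by
  rw [← cosT_sq_eq_cos_sq]
  exact norm_sq_dotProduct_tensorPow_magicT_le hφ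

/-- `|+⟩ = H|0⟩`, the optimal stabilizer witness for `|T⟩` (`|+⟩^{⊗n}` generates the optimal
decomposition). [cite: BravyiEtAl2019, §5.3 (`|+⟩^{⊗n}` attains `F(T^{⊗n})`)] -/
def plusState : QReg 1 → ℂ := hGate *ᵥ zeroState 1

/-- `|+⟩` is a stabilizer state (tree: `plusState_mem_stabilizerStates`). [folklore] -/
private theorem plusState_mem : plusState ∈ stabilizerStates 1 := plusState_mem_stabilizerStates

/-- `⟨+|T⟩ = (1+ω)/2` (in Bravyi–Gosset's `H`-picture: `⟨0|H⟩ = ν`).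
[cite: BravyiGosset2016, Suppl. §5 Lemma 2 (proof: `⟨0^{⊗t}|H^{⊗t}⟩ = ν^t`)] -/
theorem dotProduct_plusState_magicT : star plusState ⬝ᵥ magicT = (1 + omega) / 2 := by
  unfold plusState
  rw [CliffordSim.hGate_mulVec_zeroState]
  simp only [dotProduct, Pi.star_apply]
  rw [sum_qReg_one, Fintype.sum_bool]
  simp only [CliffordSim.magicT_apply, if_true, Bool.false_eq_true, if_false]
  have hstar : star (invSqrt2 : ℂ) = invSqrt2 := by simp [invSqrt2]
  have h2 : (invSqrt2 : ℂ) * invSqrt2 = 1 / 2 := invSqrt2_mul_invSqrt2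
  rw [hstar]
  linear_combination (omega + 1) * h2

/-- **(E3) is attained** at `|+⟩^{⊗n}`: `|⟨+^{⊗n}|T^{⊗n}⟩|² = C^{2n}`. [cite: BravyiEtAl2019, §5.3] -/
theorem norm_sq_dotProduct_plusPow_magicT (n : ℕ) :
    ‖star (tensorPow plusState n) ⬝ᵥ tensorPow magicT n‖ ^ 2 = (cosT ^ 2) ^ n := by
  rw [dotProduct_tensorPow, dotProduct_plusState_magicT, norm_pow, ← pow_mul, mul_comm, pow_mul]
  rfl

end fidelity

/-! ### §5 (E2) weak duality, (E4) the extent floor, (E5) the conditioning dichotomy -/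

section duality

variable {n : ℕ}

/-- **(E2) Weak duality for the `ℓ₁` problem**: if `|⟨φᵢ|ω⟩| ≤ f` for the states of a decomposition
`ψ = Σ cᵢ φᵢ`, then `|⟨ω|ψ⟩| ≤ f · Σ|cᵢ|`.
[cite: BravyiEtAl2019, §5.3, proof of Prop. 2 (`1 = |Σⱼ cⱼ⟨ψ|φⱼ⟩| ≤ ‖c‖₁ √F(ψ)`) and Thm. 4] -/
theorem weak_duality {ι : Type*} (s : Finset ι) (c : ι → ℂ) (φ : ι → QReg n → ℂ) (ω ψ : QReg n → ℂ)
    (f : ℝ) (hf : ∀ i ∈ s, ‖star (φ i) ⬝ᵥ ω‖ ≤ f) (hψ : ψ = ∑ i ∈ s, c i • φ i) :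
    ‖star ω ⬝ᵥ ψ‖ ≤ f * ∑ i ∈ s, ‖c i‖ := by
  rw [hψ, dotProduct_sum_smul, Finset.mul_sum]
  refine (norm_sum_le _ _).trans (Finset.sum_le_sum fun i hi => ?_)
  rw [norm_mul, norm_dotProduct_comm, mul_comm]
  exact mul_le_mul_of_nonneg_right (hf i hi) (norm_nonneg _)

/-- **(E4) The extent floor**: every stabilizer decomposition `T^{⊗n} = Σ cᵢ φᵢ` has
`(Σ|cᵢ|)² ≥ C^{-2n} = cos(π/8)^{-2n}` (weak duality with the dual witness `ω = T^{⊗n}` itself and (E3)).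
[cite: BravyiEtAl2019, Prop. 2 and §5.3] -/
theorem extent_floor {ι : Type*} (s : Finset ι) (c : ι → ℂ) (φ : ι → QReg n → ℂ)
    (hφ : ∀ i ∈ s, φ i ∈ stabilizerStates n) (h : tensorPow magicT n = ∑ i ∈ s, c i • φ i) :
    ((cosT ^ 2) ^ n)⁻¹ ≤ (∑ i ∈ s, ‖c i‖) ^ 2 := by
  have hunit : star (tensorPow magicT n) ⬝ᵥ tensorPow magicT n = 1 := by
    rw [← ofReal_normSq_eq_dotProduct, normSq_tensorPow, normSq_magicT, one_pow]
    simp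
  have hC : 0 < (cosT ^ 2) ^ n := by
    apply pow_pos
    rw [cosT_sq]
    have := Real.sqrt_nonneg 2
    positivity
  have hwd := weak_duality s c φ (tensorPow magicT n) (tensorPow magicT n) (cosT ^ n)
    (fun i hi => by
      have h2 := norm_sq_dotProduct_tensorPow_magicT_le (hφ i hi)
      rw [← pow_mul, mul_comm 2 n, pow_mul] at h2
      exact (pow_le_pow_iff_left₀ (norm_nonneg _) (pow_nonneg cosT_nonneg n) two_ne_zero).1 h2) h
  rw [hunit, norm_one] at hwd
  have h3 : (1 : ℝ) ≤ ((cosT ^ n) * ∑ i ∈ s, ‖c i‖) ^ 2 := by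
    have h0 : (0 : ℝ) ≤ cosT ^ n * ∑ i ∈ s, ‖c i‖ :=
      mul_nonneg (pow_nonneg cosT_nonneg n) (Finset.sum_nonneg fun i _ => norm_nonneg (c i))
    nlinarith [hwd, h0]
  rw [mul_pow, ← pow_mul, mul_comm n 2, pow_mul] at h3
  exact (inv_le_iff_one_le_mul₀' hC).2 h3

/-- (E4) in printed units: `(Σ|cᵢ|)² ≥ (cos²(π/8))^{-n}` for every stabilizer decomposition of
`T^{⊗n}`. [cite: BravyiEtAl2019, Prop. 2 and §5.3] -/
theorem extent_floor_cos {k : ℕ} (c : Fin k → ℂ) (φ : Fin k → QReg n → ℂ)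
    (hφ : ∀ i, φ i ∈ stabilizerStates n) (h : tensorPow magicT n = ∑ i, c i • φ i) :
    ((Real.cos (Real.pi / 8) ^ 2) ^ n)⁻¹ ≤ (∑ i, ‖c i‖) ^ 2 := by
  rw [← cosT_sq_eq_cos_sq]
  exact extent_floor Finset.univ c φ (fun i _ => hφ i) h

/-- **(E5) The conditioning dichotomy** (Bravyi–Gosset 2016, Suppl. Lemma 2, with its constant): a
`k`-term stabilizer decomposition `T^{⊗n} = Σ_{i<k} cᵢ φᵢ` has `k · ‖c‖₂² ≥ cos(π/8)^{-2n}` — few terms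
force exponentially large coefficients. [cite: BravyiGosset2016, Suppl. §5 Lemma 2] -/
theorem card_mul_l2_ge {k : ℕ} (c : Fin k → ℂ) (φ : Fin k → QReg n → ℂ)
    (hφ : ∀ i, φ i ∈ stabilizerStates n) (h : tensorPow magicT n = ∑ i, c i • φ i) :
    ((Real.cos (Real.pi / 8) ^ 2) ^ n)⁻¹ ≤ k * ∑ i, ‖c i‖ ^ 2 := by
  refine (extent_floor_cos c φ hφ h).trans ?_
  -- Cauchy–Schwarz `(Σ |cᵢ| · 1)² ≤ (Σ |cᵢ|²)(Σ 1)`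
  have := Finset.sum_mul_sq_le_sq_mul_sq Finset.univ (fun i => ‖c i‖) (fun _ => (1 : ℝ))
  simp only [mul_one, one_pow, Finset.sum_const, Finset.card_univ, Fintype.card_fin, nsmul_eq_mul,
    mul_one] at this
  linarith [this]

/-- **(E5′) Orthogonal decompositions are exponentially long**: if the stabilizer states of a
decomposition `T^{⊗n} = Σ_{i<k} cᵢ φᵢ` are pairwise orthogonal then `k ≥ cos(π/8)^{-2n} ≥ 2^{0.228 n}`
(`‖c‖₂ = ‖T^{⊗n}‖ = 1` by Pythagoras). [cite: BravyiGosset2016, Suppl. §5 Lemma 2 (f = ‖z‖ = 1)] -/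
theorem card_ge_of_orthogonal {k : ℕ} (c : Fin k → ℂ) (φ : Fin k → QReg n → ℂ)
    (hφ : ∀ i, φ i ∈ stabilizerStates n) (horth : ∀ i j, i ≠ j → star (φ i) ⬝ᵥ φ j = 0)
    (h : tensorPow magicT n = ∑ i, c i • φ i) :
    ((Real.cos (Real.pi / 8) ^ 2) ^ n)⁻¹ ≤ k := by
  have hl2 : ∑ i, ‖c i‖ ^ 2 = 1 := by
    have hunit : star (tensorPow magicT n) ⬝ᵥ tensorPow magicT n = 1 := by
      rw [← ofReal_normSq_eq_dotProduct, normSq_tensorPow, normSq_magicT, one_pow]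
      simp
    have hexp : star (tensorPow magicT n) ⬝ᵥ tensorPow magicT n = ∑ i, ((‖c i‖ ^ 2 : ℝ) : ℂ) := by
      conv_lhs => rw [h]
      rw [star_sum, sum_dotProduct]
      refine Finset.sum_congr rfl fun i _ => ?_
      rw [star_smul, smul_dotProduct, dotProduct_sum_smul, Finset.sum_eq_single i]
      · rw [← ofReal_normSq_eq_dotProduct, normSq_of_mem_stabilizerStates (hφ i), smul_eq_mul]
        push_cast
        rw [mul_one, Complex.star_def, Complex.conj_mul']
      · intro j _ hj
        rw [horth i j (Ne.symm hj), mul_zero]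
      · simp
    have := hunit.symm.trans hexp
    rw [← Complex.ofReal_sum] at this
    exact_mod_cast this.symm
  have h5 := card_mul_l2_ge c φ hφ h
  rw [hl2, mul_one] at h5
  exact h5

end duality

/-! ### §6 The record: `F(T^{⊗n})` and `ξ(T^{⊗n})` exactly; the constant `ξ(T) = 4 - 2√2` -/

section record

variable {n : ℕ}

/-- The **stabilizer fidelity** `F(ψ) = max_φ |⟨φ|ψ⟩|²` over stabilizer states `φ` (which are unit
vectors). [cite: BravyiEtAl2019, §2.2 Def. 4] -/
def stabilizerFidelity (ψ : QReg n → ℂ) : ℝ :=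
  sSup {f : ℝ | ∃ φ ∈ stabilizerStates n, f = ‖star φ ⬝ᵥ ψ‖ ^ 2}

/-- The **stabilizer extent** `ξ(ψ) = min (Σ|cᵢ|)²` over stabilizer decompositions `ψ = Σ cᵢ φᵢ` with
stabilizer states `φᵢ`. [cite: BravyiEtAl2019, §2.1 Def. 3] -/
def stabilizerExtent (ψ : QReg n → ℂ) : ℝ :=
  sInf {r : ℝ | ∃ (k : ℕ) (c : Fin k → ℂ) (φ : Fin k → QReg n → ℂ),
    (∀ i, φ i ∈ stabilizerStates n) ∧ ψ = ∑ i, c i • φ i ∧ r = (∑ i, ‖c i‖) ^ 2}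

/-- The fidelity set of `T^{⊗n}` has the GREATEST element `cos(π/8)^{2n}` (attained at `|+⟩^{⊗n}`), so the
`sSup` below is a maximum, not a junk value. [cite: BravyiGosset2016, Suppl. §5 eq. (max1)] -/
theorem isGreatest_fidelitySet_tensorPow_magicT (n : ℕ) :
    IsGreatest {f : ℝ | ∃ φ ∈ stabilizerStates n, f = ‖star φ ⬝ᵥ tensorPow magicT n‖ ^ 2}
      ((Real.cos (Real.pi / 8) ^ 2) ^ n) := by
  refine ⟨⟨tensorPow plusState n, tensorPow_mem_stabilizerStates plusState_mem n, ?_⟩, ?_⟩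
  · rw [norm_sq_dotProduct_plusPow_magicT, cosT_sq_eq_cos_sq]
  · rintro f ⟨φ, hφ, rfl⟩
    exact stabilizer_overlap_sq_le_cos hφ

/-- **`F(T^{⊗n}) = cos(π/8)^{2n}`** exactly. [cite: BravyiGosset2016, Suppl. §5 eq. (max1); BravyiEtAl2019, §5.3] -/
theorem stabilizerFidelity_tensorPow_magicT (n : ℕ) :
    stabilizerFidelity (tensorPow magicT n) = (Real.cos (Real.pi / 8) ^ 2) ^ n :=
  (isGreatest_fidelitySet_tensorPow_magicT n).csSup_eq

/-- A decomposition of `T^{⊗n}` attaining `(Σ|cᵢ|)² = cos(π/8)^{-2n}` (the tree's product decomposition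
over `|+⟩, |+i⟩`, `exists_decomposition_tensorPow` + `norm_coeff_magicT_sq`). [cite: BravyiEtAl2019, §5.3] -/
theorem exists_decomposition_attaining (n : ℕ) :
    ∃ (k : ℕ) (c : Fin k → ℂ) (φ : Fin k → QReg n → ℂ), (∀ i, φ i ∈ stabilizerStates n) ∧
      tensorPow magicT n = ∑ i, c i • φ i ∧ (∑ i, ‖c i‖) ^ 2 = ((Real.cos (Real.pi / 8) ^ 2) ^ n)⁻¹ := by
  have h1 : magicT = ∑ b : Fin 2, ![omega / (1 + omega), 1 / (1 + omega)] b •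
      ![hGate *ᵥ zeroState 1, sGate *ᵥ (hGate *ᵥ zeroState 1)] b := by
    rw [Fin.sum_univ_two]
    simpa using magicT_eq_smul_add_smul
  have hσ : ∀ b : Fin 2, ![hGate *ᵥ zeroState 1, sGate *ᵥ (hGate *ᵥ zeroState 1)] b ∈
      stabilizerStates 1 := by
    intro b
    fin_cases b
    · exact plusState_mem_stabilizerStates
    · exact plusIState_mem_stabilizerStates
  have hσ₁ : ∀ b : Fin 2,
      normSq (![hGate *ᵥ zeroState 1, sGate *ᵥ (hGate *ᵥ zeroState 1)] b) = 1 := by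
    intro b
    fin_cases b
    · exact normSq_plusState
    · exact normSq_plusIState
  have hd : ∑ b : Fin 2, ‖![omega / (1 + omega), 1 / (1 + omega)] b‖ =
      ‖omega / (1 + omega)‖ + ‖(1 : ℂ) / (1 + omega)‖ := by
    rw [Fin.sum_univ_two]
    simp
  obtain ⟨ι, _, c, Φ, hΦ, _, hdec, hsum⟩ := exists_decomposition_tensorPow magicT _ _ hσ hσ₁ h1 n
  set e := (Fintype.equivFin ι).symm with he
  refine ⟨Fintype.card ι, fun j => c (e j), fun j => Φ (e j), fun j => hΦ (e j), ?_, ?_⟩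
  · rw [hdec]
    exact (e.sum_comp (fun i => c i • Φ i)).symm
  · rw [e.sum_comp (fun i => ‖c i‖), hsum, hd, ← pow_mul, mul_comm n 2, pow_mul, norm_coeff_magicT_sq,
      inv_pow]

/-- The extent set of `T^{⊗n}` has the LEAST element `cos(π/8)^{-2n}` (attained by the product
decomposition over `|+⟩, |+i⟩`), so the `sInf` below is a minimum, not a junk value: the tree's
sparsification input `‖c‖₁² = cos(π/8)^{-2n}` (`BravyiEtAl2019_approxStabilizerRank_magicT_pow_holds`)
is optimal among ALL stabilizer decompositions. [cite: BravyiEtAl2019, Prop. 2 and §5.3] -/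
theorem isLeast_extentSet_tensorPow_magicT (n : ℕ) :
    IsLeast {r : ℝ | ∃ (k : ℕ) (c : Fin k → ℂ) (φ : Fin k → QReg n → ℂ),
      (∀ i, φ i ∈ stabilizerStates n) ∧ tensorPow magicT n = ∑ i, c i • φ i ∧ r = (∑ i, ‖c i‖) ^ 2}
      (((Real.cos (Real.pi / 8) ^ 2) ^ n)⁻¹) := by
  refine ⟨?_, ?_⟩
  · obtain ⟨k, c, φ, hφ, hdec, hval⟩ := exists_decomposition_attaining n
    exact ⟨k, c, φ, hφ, hdec, hval.symm⟩
  · rintro r ⟨k, c, φ, hφ, hdec, rfl⟩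
    exact extent_floor_cos c φ hφ hdec

/-- **`ξ(T^{⊗n}) = cos(π/8)^{-2n}`** exactly. [cite: BravyiEtAl2019, Prop. 2 and §5.3] -/
theorem stabilizerExtent_tensorPow_magicT (n : ℕ) :
    stabilizerExtent (tensorPow magicT n) = ((Real.cos (Real.pi / 8) ^ 2) ^ n)⁻¹ :=
  (isLeast_extentSet_tensorPow_magicT n).csInf_eq

/-- The one-copy constant: `cos(π/8)^{-2} = ξ(T) = 4 - 2√2 = 2^{0.22844…}`.
[cite: BravyiGosset2016, p. 3 (`γ ≤ -2 log₂ cos(π/8) ≈ 0.228`)] -/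
theorem inv_cos_sq_pi_div_eight : (Real.cos (Real.pi / 8) ^ 2)⁻¹ = 4 - 2 * Real.sqrt 2 := by
  rw [← cosT_sq_eq_cos_sq, cosT_sq, inv_div, div_eq_iff (by have := Real.sqrt_nonneg 2; positivity)]
  have hs := sqrt2_sq'
  linear_combination (2 : ℝ) * hs

/-- Numbers (the `m = 1, 2` falsifier values): `F(T) = cos²(π/8) = (2+√2)/4 ∈ (0.85355, 0.85356)` (so
`F(T^{⊗2}) = cos⁴(π/8) ∈ (0.7285, 0.7286)`, above the Bell-pair value `1/4`).
[cite: BravyiGosset2016, Suppl. §5 eq. (max1) (`F_1 = ν`, `ν = cos(π/8)`)] -/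
theorem cos_sq_pi_div_eight_bounds : (85355 / 100000 : ℝ) < Real.cos (Real.pi / 8) ^ 2 ∧
    Real.cos (Real.pi / 8) ^ 2 < 85356 / 100000 := by
  rw [← cosT_sq_eq_cos_sq, cosT_sq]
  have hs := sqrt2_sq'
  have h0 := Real.sqrt_nonneg 2
  constructor <;> nlinarith [hs, h0]

/-- Certified decimals: `1.17157 < ξ(T) = 4 - 2√2 < 1.171574` (from `1.414213 < √2 < 1.414215`).
[cite: BravyiGosset2016, p. 3 (`γ ≤ -2 log₂ cos(π/8) ≈ 0.228`)] -/
theorem xi_T_bounds : (117157 / 100000 : ℝ) < 4 - 2 * Real.sqrt 2 ∧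
    4 - 2 * Real.sqrt 2 < 1171574 / 1000000 := by
  have hs := sqrt2_sq'
  have h0 := Real.sqrt_nonneg 2
  constructor <;> nlinarith [hs, h0]

/-- `2^{0.2284} ≤ 2^{45/197} < 1.17157` (raise to the 197-th power: `2^{45} < 1.17157^{197}`). [folklore] -/
private theorem two_rpow_lower_lt : (2 : ℝ) ^ (0.2284 : ℝ) < 117157 / 100000 := by
  have h1 : ((2 : ℝ) ^ ((45 : ℝ) / 197)) ^ (197 : ℕ) = (2 : ℝ) ^ (45 : ℕ) := by
    rw [← Real.rpow_natCast, ← Real.rpow_mul (by norm_num),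
      show ((45 : ℝ) / 197 * ((197 : ℕ) : ℝ)) = ((45 : ℕ) : ℝ) by norm_num, Real.rpow_natCast]
  have h2 : (2 : ℝ) ^ ((45 : ℝ) / 197) < 117157 / 100000 := by
    by_contra h
    have h3 := pow_le_pow_left₀ (by norm_num) (not_lt.1 h) 197
    rw [h1] at h3
    norm_num at h3
  exact (Real.rpow_le_rpow_of_exponent_le one_le_two (by norm_num)).trans_lt h2

/-- `1.171574 < 2^{53/232} ≤ 2^{0.2285}` (raise to the 232-th power: `1.171574^{232} < 2^{53}`). [folklore] -/
private theorem lt_two_rpow_upper : (1171574 / 1000000 : ℝ) < (2 : ℝ) ^ (0.2285 : ℝ) := by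
  have h1 : ((2 : ℝ) ^ ((53 : ℝ) / 232)) ^ (232 : ℕ) = (2 : ℝ) ^ (53 : ℕ) := by
    rw [← Real.rpow_natCast, ← Real.rpow_mul (by norm_num),
      show ((53 : ℝ) / 232 * ((232 : ℕ) : ℝ)) = ((53 : ℕ) : ℝ) by norm_num, Real.rpow_natCast]
  have h2 : (1171574 / 1000000 : ℝ) < (2 : ℝ) ^ ((53 : ℝ) / 232) := by
    by_contra h
    have h3 := pow_le_pow_left₀ (Real.rpow_nonneg (by norm_num) _) (not_lt.1 h) 232
    rw [h1] at h3
    norm_num at h3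
  exact h2.trans_le (Real.rpow_le_rpow_of_exponent_le one_le_two (by norm_num))

/-- **(F-d) The exponent, certified**: `ξ(T) = 4 - 2√2 = 2^γ` with `γ = log₂ ξ(T) ∈ (0.2284, 0.2285)`,
hence `ξ(T^{⊗n}) = 2^{γ n}` and every `ℓ₁` or orthogonal floor above reads `≥ 2^{0.2284 n}`.
[cite: BravyiGosset2016, p. 3 (`γ ≤ -2 log₂ cos(π/8) ≈ 0.228`)] -/
theorem gamma_bounds : (0.2284 : ℝ) < Real.logb 2 (4 - 2 * Real.sqrt 2) ∧
    Real.logb 2 (4 - 2 * Real.sqrt 2) < 0.2285 := by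
  have hx : (0 : ℝ) < 4 - 2 * Real.sqrt 2 := lt_trans (by norm_num) xi_T_bounds.1
  constructor
  · exact (Real.lt_logb_iff_rpow_lt one_lt_two hx).2 (two_rpow_lower_lt.trans xi_T_bounds.1)
  · exact (Real.logb_lt_iff_lt_rpow one_lt_two hx).2 (xi_T_bounds.2.trans lt_two_rpow_upper)

/-- The certified floor in exponent form: `2^{0.2284 n} ≤ ξ(T^{⊗n})`.
[cite: BravyiEtAl2019, Prop. 2 and §5.3 (`ξ(T^{⊗n}) = cos(π/8)^{-2n}`); BravyiGosset2016, p. 3 (`≈ 2^{0.228 n}`)] -/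
theorem two_rpow_mul_le_stabilizerExtent (n : ℕ) :
    (2 : ℝ) ^ ((0.2284 : ℝ) * n) ≤ stabilizerExtent (tensorPow magicT n) := by
  rw [stabilizerExtent_tensorPow_magicT, ← inv_pow, inv_cos_sq_pi_div_eight, Real.rpow_mul_natCast (by norm_num)]
  exact pow_le_pow_left₀ (Real.rpow_nonneg (by norm_num) _)
    (two_rpow_lower_lt.trans xi_T_bounds.1).le n

end record

end StabilizerFidelity

end Literature.Computability.QuantumComplexity
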